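import Literature.NumberTheory.Weil1964.AdicCompletionLerayIndexEighthRoot
import HarnessLib

/-!
# At a finite place `K_v` the Leray extension reduces to an extension of `Sp(B)` by `μ₈`

Topic `NumberTheory/Weil1964`; namespace `Literature.NumberTheory.Weil1964`. KERNEL mathematics only (definitions
with bodies + theorems; no named fact, no `axiom`, no `sorry`). Sequel of `AdicCompletionLerayIndexEighthRoot.lean`
(`lerayCentralCocycle_pow_eight`: at `K_v` the Leray cocycle is an eighth root of unity).

[MoeglinVignerasWaldspurger1987, Chap. 3 §I.3, remarque b)]: "`c(g, g')` est une racine huitième de l'unité" —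
so over `K_v` the Leray cocycle is a `2`-cocycle with values in the finite cyclic group `μ₈ = rootsOfUnity 8 ℂ`
(`lerayCentralCocycleMu8`), whose push-forward along `μ₈ ↪ ℂˣ` is the `ℂˣ`-valued cocycle of
`LocalLerayCocycle.lean` (`lerayCentralCocycleMu8_map_subtype`), and the corresponding twisted product
`Sp(B) ×_c μ₈` (`LerayMetaplecticMu8`) is a FINITE central extension `1 → μ₈ → S̃p → Sp(B) → 1` mapping
homomorphically into `LerayMetaplectic` over `Sp(B)` (`LerayMetaplecticMu8.toLerayMetaplectic`).

## References

* [MoeglinVignerasWaldspurger1987] C. Mœglin, M.-F. Vignéras, J.-L. Waldspurger, *Correspondances de Howe sur un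
  corps p-adique*, LNM 1291 (1987), Chap. 3 §I.3, remarque b).
-/

set_option autoImplicit false

noncomputable section

open MeasureTheory Set NumberField IsDedekindDomain
open Literature.RepresentationTheory.HeisenbergGroup
open Literature.GroupTheory

namespace Literature.NumberTheory.Weil1964

variable (K : Type) [Field K] [NumberField K] (v : HeightOneSpectrum (𝓞 K))
variable [MeasurableSpace (v.adicCompletion K)] [BorelSpace (v.adicCompletion K)]
  (μ : Measure (v.adicCompletion K)) [μ.IsAddHaarMeasure] {ψ : AddChar (v.adicCompletion K) Circle}
  [Invertible (2 : v.adicCompletion K)]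
variable {V : Type*} [AddCommGroup V] [Module (v.adicCompletion K) V] [FiniteDimensional (v.adicCompletion K) V]

/-- **the `μ₈`-valued Leray cocycle of `Sp(B)` over `K_v`**: `c(g₁, g₂) ∈ μ₈ = rootsOfUnity 8 ℂ`.
[cite: MoeglinVignerasWaldspurger1987, Chap. 3 §I.3, remarque b)] -/
def lerayCentralCocycleMu8 (hψ : ψ.IsContinuousNontrivial) {B : LinearMap.BilinForm (v.adicCompletion K) V}
    (hB : LinearMap.IsAlt B) (hN : B.Nondegenerate) {ℓ : Submodule (v.adicCompletion K) V}
    (hℓ : B.orthogonal ℓ = ℓ) :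
    CentralCocycle (Heisenberg.PseudoSymplectic.isometries B) (rootsOfUnity 8 ℂ) where
  toFun g₁ g₂ := ⟨lerayCentralCocycle μ hψ hB hN hℓ g₁ g₂,
    (mem_rootsOfUnity 8 _).2 (lerayCentralCocycle_pow_eight K v μ hψ hB hN hℓ g₁ g₂)⟩
  cocycle' g₁ g₂ g₃ := Subtype.ext ((lerayCentralCocycle μ hψ hB hN hℓ).cocycle g₁ g₂ g₃)
  map_one_one' := Subtype.ext (lerayCentralCocycle μ hψ hB hN hℓ).map_one_one

/-- its value in `ℂˣ` is the Leray cocycle. [cite: MoeglinVignerasWaldspurger1987, Chap. 3 §I.3, remarque b)] -/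
@[simp] theorem coe_lerayCentralCocycleMu8 (hψ : ψ.IsContinuousNontrivial)
    {B : LinearMap.BilinForm (v.adicCompletion K) V} (hB : LinearMap.IsAlt B) (hN : B.Nondegenerate)
    {ℓ : Submodule (v.adicCompletion K) V} (hℓ : B.orthogonal ℓ = ℓ)
    (g₁ g₂ : Heisenberg.PseudoSymplectic.isometries B) :
    ((lerayCentralCocycleMu8 K v μ hψ hB hN hℓ g₁ g₂ : rootsOfUnity 8 ℂ) : ℂˣ) =
      lerayCentralCocycle μ hψ hB hN hℓ g₁ g₂ := rfl

/-- **push-forward along `μ₈ ↪ ℂˣ` recovers the `ℂˣ`-valued Leray cocycle** (tree `CentralCocycle.map`).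
[cite: MoeglinVignerasWaldspurger1987, Chap. 3 §I.3, remarque b)] -/
theorem lerayCentralCocycleMu8_map_subtype (hψ : ψ.IsContinuousNontrivial)
    {B : LinearMap.BilinForm (v.adicCompletion K) V} (hB : LinearMap.IsAlt B) (hN : B.Nondegenerate)
    {ℓ : Submodule (v.adicCompletion K) V} (hℓ : B.orthogonal ℓ = ℓ) :
    (lerayCentralCocycleMu8 K v μ hψ hB hN hℓ).map (rootsOfUnity 8 ℂ).subtype = lerayCentralCocycle μ hψ hB hN hℓ :=
  CentralCocycle.ext fun _ _ => rfl

/-- **the finite central extension `Sp(B) ×_c μ₈`** of `Sp(B)` by `μ₈` at the place `v`.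
[cite: MoeglinVignerasWaldspurger1987, Chap. 3 §I.3, remarque b)] -/
abbrev LerayMetaplecticMu8 (hψ : ψ.IsContinuousNontrivial) {B : LinearMap.BilinForm (v.adicCompletion K) V}
    (hB : LinearMap.IsAlt B) (hN : B.Nondegenerate) {ℓ : Submodule (v.adicCompletion K) V}
    (hℓ : B.orthogonal ℓ = ℓ) : Type _ :=
  TwistedProduct (lerayCentralCocycleMu8 K v μ hψ hB hN hℓ)

/-- it is a central extension `1 → μ₈ → Sp(B) ×_c μ₈ → Sp(B) → 1` (tree `TwistedProduct.isCentralExt`).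
[cite: MoeglinVignerasWaldspurger1987, Chap. 3 §I.3, remarque b)] -/
theorem LerayMetaplecticMu8.isCentralExt (hψ : ψ.IsContinuousNontrivial)
    {B : LinearMap.BilinForm (v.adicCompletion K) V} (hB : LinearMap.IsAlt B) (hN : B.Nondegenerate)
    {ℓ : Submodule (v.adicCompletion K) V} (hℓ : B.orthogonal ℓ = ℓ) :
    Literature.RepresentationTheory.MoeglinVignerasWaldspurger1987.IsCentralExt
      (TwistedProduct.inl (lerayCentralCocycleMu8 K v μ hψ hB hN hℓ))
      (TwistedProduct.fst (lerayCentralCocycleMu8 K v μ hψ hB hN hℓ)) :=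
  TwistedProduct.isCentralExt _

/-- **`Sp(B) ×_c μ₈ →* LerayMetaplectic`, `(g, ζ) ↦ (g, ζ)`**: the `μ₈`-extension sits inside the `ℂˣ`-extension,
over `Sp(B)`. [cite: MoeglinVignerasWaldspurger1987, Chap. 3 §I.3, remarque b)] -/
def LerayMetaplecticMu8.toLerayMetaplectic (hψ : ψ.IsContinuousNontrivial)
    {B : LinearMap.BilinForm (v.adicCompletion K) V} (hB : LinearMap.IsAlt B) (hN : B.Nondegenerate)
    {ℓ : Submodule (v.adicCompletion K) V} (hℓ : B.orthogonal ℓ = ℓ) :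
    LerayMetaplecticMu8 K v μ hψ hB hN hℓ →* LerayMetaplectic μ hψ hB hN hℓ where
  toFun x := ⟨x.g, (x.a : ℂˣ)⟩
  map_one' := rfl
  map_mul' x y := by
    refine TwistedProduct.ext rfl ?_
    simp only [TwistedProduct.mul_a, Subgroup.coe_mul, coe_lerayCentralCocycleMu8]

/-- the comparison map is over `Sp(B)`. [cite: MoeglinVignerasWaldspurger1987, Chap. 3 §I.3, remarque b)] -/
@[simp] theorem LerayMetaplecticMu8.toLerayMetaplectic_g (hψ : ψ.IsContinuousNontrivial)
    {B : LinearMap.BilinForm (v.adicCompletion K) V} (hB : LinearMap.IsAlt B) (hN : B.Nondegenerate)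
    {ℓ : Submodule (v.adicCompletion K) V} (hℓ : B.orthogonal ℓ = ℓ) (x : LerayMetaplecticMu8 K v μ hψ hB hN hℓ) :
    (LerayMetaplecticMu8.toLerayMetaplectic K v μ hψ hB hN hℓ x).g = x.g := rfl

/-- the comparison map is injective. [cite: MoeglinVignerasWaldspurger1987, Chap. 3 §I.3, remarque b)] -/
theorem LerayMetaplecticMu8.toLerayMetaplectic_injective (hψ : ψ.IsContinuousNontrivial)
    {B : LinearMap.BilinForm (v.adicCompletion K) V} (hB : LinearMap.IsAlt B) (hN : B.Nondegenerate)
    {ℓ : Submodule (v.adicCompletion K) V} (hℓ : B.orthogonal ℓ = ℓ) :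
    Function.Injective (LerayMetaplecticMu8.toLerayMetaplectic K v μ hψ hB hN hℓ) := by
  intro x y h
  have hg := congrArg TwistedProduct.g h
  have ha := congrArg TwistedProduct.a h
  exact TwistedProduct.ext hg (Subtype.ext ha)

end Literature.NumberTheory.Weil1964
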